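import Summits.BirchSwinnertonDyer.Rank1Residual.GaloisImage.WildNineTorsionAbscissaValuation
import Summits.BirchSwinnertonDyer.Rank1Residual.GaloisImage.ThreeTorsionCubeRootDelta
import HarnessLib

/-!
# The `3`-adic tower INSIDE the EXOTIC core `v₃(j − 1728) = 3`: the rows with `3 ∣ v₃(c₆)`,
# `v₃(j) ≥ 6` and `2c₆/Δ` a `3`-adic cube to second order (`c₆′ ≡ ±2 mod 9`) — binder-free
# (cell `b2b-bsdres`, team n1011, seat p02 gen 4 — row T-b11 ARM A 'm = 3 structure', file F3c)

HONEST FRAMING (cell `b2b-bsdres`, run/shared/lean/b2b/bsd-rank1-residual/, verbatim in every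
file): the goal of the cell is to DELETE the COMBINATION-SHAPED residual classes of the
Birch–Swinnerton-Dyer formula for ALL analytic-rank `≤ 1` elliptic curves over `ℚ` — "full BSD
formula for every rank `≤ 1` curve in class `C`" assembled STRICTLY from published theorems — so
that the rank-`≤ 1` remainder becomes exactly the CONSTRUCTION-SHAPED classes, which are TYPED
(missing-input `Prop`s), NOT attempted. This is not "finishing BSD". Team n1011 (N10 / N11):
research route; no claim beyond the stated classes; labels UNCHANGED; nothing is booked. Theorems
only (no definition, no named fact).

## What this file proves

Let `E = W/ℚ` be given by a model integral at `3` in the sense `v₃(c₄) = n₄`, `v₃(c₆) = n₆`,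
`v₃(Δ) = n_Δ` with `n₄ n₆ n_Δ : ℕ`, and suppose

* `2·n₆ = n_Δ + 3` — i.e. `v₃(j − 1728) = 3`, ELKIES' VALUE (`j − 1728 = c₆²/Δ`);
* `3·n₄ ≥ n_Δ + 6` — i.e. `v₃(j) ≥ 6` (`j = c₄³/Δ`);
* `3 ∣ n₆` — conductor exponent `f₃ = 3` on these rows (Ogg: `v₃(Δ_min) ≡ 3 mod 6`);
* `∃ c ∈ ℚ, v₃(c³Δ/(2c₆) − 1) ≥ 2` — `2c₆/Δ` is a `3`-adic cube to second order; on a minimal model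
  `⟺ c₆/3^{n₆} ≡ ±2 (mod 9)` (then `c = ∓4·3^{1 − n₆/3}`).

Then **`27 ∣ #ρ̄_{E,9}(I_𝔓)`** (`twentySeven_dvd_card_inertia_map_galoisRepTorsion_nine_of_cubeRoot`)
and hence, if `ρ̄_{E,3}` is onto, **`ρ̄_{E,3ⁿ}` is onto for every `n`**
(`towerSurj_three_of_surj_of_cubeRoot`; `imageContainsSL2_three_of_surj_of_cubeRoot`, Kato (12.5.2)).

MECHANISM.  ARM A's transport read on the abscissa (F3b
`exists_nineTorsion_abscissa_sub_twoTorsion_valuation`): a point `Q = (x₀, y₀)` of order `9` and a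
`2`-torsion abscissa `e` with `v(x₀ − e)¹⁶² v(3)³ = v(Δ)²⁷`, i.e. `val(x₀ − e) = n₆/3 − 14/27`.  The
element `e` is NOT in `ℚ(E[9])`, but under the hypotheses it is `3`-adically within `n₆/3 − 9/27` of
`β = (c·ωᵏδ − b₂)/12 ∈ ℚ(E[3])` for one of the three cube roots `ωᵏδ` of `Δ` (F3a
`exists_cubeRoots_Δ_mem_divisionField_three`): with `z = 12e + b₂` one has `z³ = 3c₄z + 2c₆`
(the `2`-division cubic, tree `mul_Ψ₂Sq_eval_eq`) and
`∏ₖ (z − cωᵏδ) = z³ − c³Δ = (2c₆ − c³Δ) + 3c₄z` has valuation `≥ n₆ + 2`, so one factor has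
valuation `≥ (n₆ + 2)/3`.  Hence `x₀ − β ∈ ℚ(E[9])` has `val = n₆/3 − 14/27`, denominator `27`:
`27 ∣ #ρ̄₉(I_𝔓)` by the count socket (gen 2, p254468) — more than the `3` scalars — and the tower
follows from the first-order witness (p252833).  On the other wild `m = 3` rows (`c₆′ ≡ ±1, ±4`)
no rational multiple of a cube root of `Δ` is that close to `e`, and indeed Elkies' curves live
there.

NUMERICS (EVIDENCE, `HOME/b2b-bsdres-n1011-p02/m3/M3-LOCAL-NOTE.md` §6): the hypotheses single out
154 of the 749 sampled m = 3 cells (all with `f₃ = 3`, `v₃ j ≥ 6`, `c₆′ ≡ ±2`), every one of which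
shows ramification index `27` on a `9`-torsion abscissa; exact check of the mechanism on 5400bu1 /
10584h1 (Newton polygon of `∏_{i,k}(w − zᵢ + cωᵏδ)`: `{v(z)+1 ×3, v(z)+1/2 ×6}`) versus the
`v₃ j = 3` cells 5940b1 / 10584i1 (`{v(z)+1/3 ×9}`).  Nothing booked; no label change.

References: [Serre1972] §5.3 (`ℚ(E[3]) ⊇ ℚ(μ₃, ∛Δ)`); [SerreLocalFields1979] Ch. I §7;
[SerreAbelianLadic1968] IV-23 Lemma 3; [Elkies2006] arXiv:math/0612734; [Kato2004Asterisque]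
(12.5.2) p. 222.
-/

noncomputable section

-- as in `WildThreeAdicTower`: numerals `x ^ 162` on the value group need a deeper recursion limit
set_option maxRecDepth 10000

open scoped Classical NumberField Pointwise

open Polynomial WeierstrassCurve Field IsDedekindDomain

namespace Summit.BirchSwinnertonDyer.Rank1Residual.GaloisImage

open Literature.NumberTheory.EllipticCurves Literature.NumberTheory.GaloisRepresentations
  Rat.HeightOneSpectrum

variable (W : WeierstrassCurve ℚ) [W.IsElliptic]

omit [W.IsElliptic] in
/-- `ℚ(E[3]) ⊆ ℚ(E[9])`. [folklore] -/
private theorem divisionField_three_le_nine : W.divisionField 3 ≤ W.divisionField 9 := by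
  intro x hx
  rw [mem_divisionField_iff] at hx ⊢
  intro σ hσ
  refine hx σ fun T ↦ ?_
  have hT9 : (T : W.geomPoints) ∈ geomTorsion W ((9 : ℕ) : ℤ) := by
    have h3 := (Submodule.mem_torsionBy_iff _ _).mp T.2
    refine (Submodule.mem_torsionBy_iff _ _).mpr ?_
    rw [show (((9 : ℕ) : ℤ)) = 3 * ((3 : ℕ) : ℤ) by norm_num, mul_smul, h3, smul_zero]
  have h1 : σ • ((T : W.geomPoints)) = T := congrArg Subtype.val (hσ ⟨(T : W.geomPoints), hT9⟩)
  exact Subtype.ext h1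

omit [W.IsElliptic] in
/-- `v(q) ≤ v(3)^k` for a rational `q` with `v₃(q) ≥ k` (or `q = 0`). [folklore] -/
private theorem valuation_ratCast_le_pow_of_le_padicValRat {q : ℚ} {k : ℕ}
    (hq : q = 0 ∨ (k : ℤ) ≤ padicValRat 3 q) :
    (placeOver 3).valuation (algebraMap ℚ (AlgebraicClosure ℚ) q) ≤ (placeOver 3).valuation (3 : (AlgebraicClosure ℚ)) ^ k := by
  rcases eq_or_ne q 0 with rfl | hq0
  · simp
  rcases hq with h | h
  · exact absurd h hq0
  obtain ⟨m, hm⟩ : ∃ m : ℕ, padicValRat 3 q = m := ⟨(padicValRat 3 q).toNat, by omega⟩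
  refine (valuation_ratCast_eq_pow_of_padicValRat hq0 hm).trans_le ?_
  have hkm : k ≤ m := by rw [hm] at h; exact_mod_cast h
  exact pow_le_pow_right_of_le_one' (le_of_lt valuation_three_lt_one) hkm

/-- **`27 ∣ #ρ̄_{E,9}(I_𝔓)` on the cube-root rows of the EXOTIC core.**  Hypotheses (module
docstring): `v₃(c₄) = n₄`, `v₃(c₆) = n₆`, `v₃(Δ) = n_Δ` naturals with `2n₆ = n_Δ + 3`
(`v₃(j − 1728) = 3`), `n_Δ + 6 ≤ 3n₄` (`v₃(j) ≥ 6`), `3 ∣ n₆`, and a rational `c` with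
`v₃(c³Δ/(2c₆) − 1) ≥ 2`.  No hypothesis on `ρ̄₃`.
[cite: SerreLocalFields1979, Ch. I §7 Cor. to Prop. 21 and Prop. 22(b)] [cite: Serre1972, §5.3] -/
theorem twentySeven_dvd_card_inertia_map_galoisRepTorsion_nine_of_cubeRoot
    {n₄ n₆ nΔ : ℕ} (hc₄ : padicValRat 3 W.c₄ = n₄) (hc₆ : padicValRat 3 W.c₆ = n₆)
    (hΔ : padicValRat 3 W.Δ = nΔ) (hm : 2 * n₆ = nΔ + 3) (hj : nΔ + 6 ≤ 3 * n₄) (h3 : 3 ∣ n₆)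
    (hc : ∃ c : ℚ, c ^ 3 * W.Δ / (2 * W.c₆) - 1 = 0 ∨
      (2 : ℤ) ≤ padicValRat 3 (c ^ 3 * W.Δ / (2 * W.c₆) - 1))
    {w : HeightOneSpectrum (𝓞 ℚ)} (hw : (primesEquiv w : ℕ) = 3)
    {𝔓 : Ideal (absIntegers (𝓞 ℚ) ℚ)}
    (hmem : ∀ x : absIntegers (𝓞 ℚ) ℚ, x ∈ 𝔓 ↔ (x : (AlgebraicClosure ℚ)) ∈ (placeOver 3).nonunits)
    (h𝔓 : 𝔓 ∈ w.primesAbove) :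
    27 ∣ Nat.card ((𝔓.inertia (absoluteGaloisGroup ℚ)).map (galoisRepTorsion W 9)) := by
  haveI : Fact (Nat.Prime 3) := ⟨Nat.prime_three⟩
  haveI : NeZero (9 : ℕ) := ⟨by norm_num⟩
  set v := (placeOver 3).valuation with hv
  set t := v (3 : AlgebraicClosure ℚ) with ht
  have ht0 : t ≠ 0 := valuation_three_ne_zero
  have ht1 : t < 1 := valuation_three_lt_one
  set V := W.map (algebraMap ℚ (AlgebraicClosure ℚ)) with hV
  -- non-vanishing of the invariants
  have hc₆0 : W.c₆ ≠ 0 := by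
    intro h0; rw [h0, padicValRat.zero] at hc₆
    have : (n₆ : ℤ) = 0 := by exact_mod_cast hc₆.symm
    omega
  have hΔ0 : W.Δ ≠ 0 := W.isUnit_Δ.ne_zero
  have hc₄0 : W.c₄ ≠ 0 := by
    intro h0; rw [h0, padicValRat.zero] at hc₄
    have : (n₄ : ℤ) = 0 := by exact_mod_cast hc₄.symm
    omega
  -- valuations of the invariants read in `ℚ̄`
  have hvc₄ : v (algebraMap ℚ (AlgebraicClosure ℚ) W.c₄) = t ^ n₄ := valuation_ratCast_eq_pow_of_padicValRat hc₄0 hc₄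
  have hvc₆ : v (algebraMap ℚ (AlgebraicClosure ℚ) W.c₆) = t ^ n₆ := valuation_ratCast_eq_pow_of_padicValRat hc₆0 hc₆
  have hvΔ : v (algebraMap ℚ (AlgebraicClosure ℚ) W.Δ) = t ^ nΔ := valuation_ratCast_eq_pow_of_padicValRat hΔ0 hΔ
  -- `v₃(j − 1728) = 3`: `j − 1728 = c₆² / Δ`
  have hj : padicValRat 3 (W.j - 1728) = ((3 : ℕ) : ℤ) := by
    have e : W.j - 1728 = W.c₆ ^ 2 / W.Δ := by
      have hinv : ((W.Δ'⁻¹ : ℚˣ) : ℚ) = W.Δ⁻¹ := by rw [Units.val_inv_eq_inv_val, W.coe_Δ']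
      rw [WeierstrassCurve.j, hinv, eq_div_iff hΔ0, sub_mul, mul_comm (W.Δ⁻¹) _, mul_assoc,
        inv_mul_cancel₀ hΔ0, mul_one]
      linear_combination (-1 : ℚ) * W.c_relation
    rw [e, padicValRat.div (pow_ne_zero 2 hc₆0) hΔ0, padicValRat.pow, hc₆, hΔ]
    push_cast; omega
  -- F3b: a `9`-torsion abscissa `x₀` and a `2`-torsion abscissa `e` with `v(x₀ − e)¹⁶² t³ = v(Δ)²⁷`
  obtain ⟨Q, x₀, y₀, e, ye, hQ, he, hQxy, hQ9, hT2, hxe0, hval⟩ :=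
    exists_nineTorsion_abscissa_sub_twoTorsion_valuation W (m := 3) (by norm_num) (by norm_num) hj
  have hval' : v (x₀ - e) ^ 162 * t ^ 3 = t ^ (27 * nΔ) := by
    rw [hvΔ, ← pow_mul, Nat.mul_comm] at hval; exact hval
  -- F3a: the cube roots of `Δ` in `ℚ(E[3])`
  obtain ⟨ω, δ, hω, hδ3, hδ0m, hδ1m, hδ2m⟩ := exists_cubeRoots_Δ_mem_divisionField_three W
  have hδ3' : δ ^ 3 = algebraMap ℚ (AlgebraicClosure ℚ) W.Δ := hδ3
  obtain ⟨c, hc⟩ := hc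
  -- the `2`-division cubic at `e`: `z³ = 3c₄ z + 2c₆`, `z = 12e + b₂`
  set z : AlgebraicClosure ℚ := 12 * e + V.b₂ with hz
  have hΨ : V.Ψ₂Sq.eval e = 0 := by
    have := (V.zsmul_some_eq_zero_iff_eval_ΨSq he 2).mp hT2
    rwa [ΨSq_two] at this
  have hz3 : z ^ 3 = 3 * V.c₄ * z + 2 * V.c₆ := by
    have := V.mul_Ψ₂Sq_eval_eq e
    rw [hΨ, mul_zero] at this
    rw [hz]; linear_combination -this
  have hVc₄ : V.c₄ = algebraMap ℚ (AlgebraicClosure ℚ) W.c₄ := by rw [hV, map_c₄]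
  have hVc₆ : V.c₆ = algebraMap ℚ (AlgebraicClosure ℚ) W.c₆ := by rw [hV, map_c₆]
  have hVb₂ : V.b₂ = algebraMap ℚ (AlgebraicClosure ℚ) W.b₂ := by rw [hV, map_b₂]
  set cK : AlgebraicClosure ℚ := algebraMap ℚ (AlgebraicClosure ℚ) c with hcK
  -- `∏ₖ (z − c ωᵏ δ) = z³ − c³ Δ = (2c₆ − c³Δ) + 3c₄ z`
  have hprod : (z - cK * δ) * (z - cK * (ω * δ)) * (z - cK * (ω ^ 2 * δ)) =
      (2 * V.c₆ - cK ^ 3 * δ ^ 3) + 3 * V.c₄ * z := by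
    linear_combination (-(z ^ 2) * (cK * δ) + ω * z * (cK * δ) ^ 2 - (ω - 1) * (cK * δ) ^ 3) * hω + hz3
  -- `n₆ = 3 n'`, `n₄ ≥ 2n' + 1`, `nΔ = 6n' − 3` (so `n' ≥ 1`)
  obtain ⟨n', hn'⟩ := h3
  have hn4 : 2 * n' + 1 ≤ n₄ := by omega
  have hn1 : 1 ≤ n' := by omega
  -- `v(z) ≤ t^{n'}`
  have hvz : v z ≤ t ^ n' := by
    by_contra hlt
    push Not at hlt
    have h3z : v (3 * V.c₄ * z) = t ^ (1 + n₄) * v z := by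
      rw [Valuation.map_mul, Valuation.map_mul, hVc₄, hvc₄, ← ht, pow_add, pow_one]
    have hz3v : v z ^ 3 = v (3 * V.c₄ * z + 2 * V.c₆) := by rw [← map_pow, hz3]
    have h2c₆ : v (2 * V.c₆) = t ^ n₆ := by
      rw [map_mul, hVc₆, hvc₆, show (2 : AlgebraicClosure ℚ) = ((2 : ℤ) : AlgebraicClosure ℚ) by norm_num,
        valuation_placeOver_intCast_eq_one 3 (n := 2) (by decide), one_mul]
    have hle := Valuation.map_add v (3 * V.c₄ * z) (2 * V.c₆)
    rw [← hz3v, h3z, h2c₆] at hle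
    rcases le_max_iff.mp hle with h | h
    · -- `v z ³ ≤ t^{1+n₄} v z` ⇒ `v z ² ≤ t^{1+n₄} ≤ t^{2n'+2}` ⇒ `v z ≤ t^{n'+1} < t^{n'}`… contradiction
      have hvz0 : 0 < v z := lt_of_le_of_lt zero_le hlt |>.trans_le' le_rfl
      have h2 : v z ^ 2 ≤ t ^ (1 + n₄) := by
        have : v z ^ 2 * v z ≤ t ^ (1 + n₄) * v z := by rw [← pow_succ]; exact h
        exact le_of_mul_le_mul_right this hvz0
      have h3 : t ^ (1 + n₄) ≤ t ^ (2 * (n' + 1)) :=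
        pow_le_pow_right_of_le_one' ht1.le (by omega)
      have h4 : v z ^ 2 ≤ (t ^ (n' + 1)) ^ 2 := by rw [← pow_mul, Nat.mul_comm]; exact h2.trans h3
      have h5 : v z ≤ t ^ (n' + 1) := (pow_le_pow_iff_left₀ zero_le zero_le two_ne_zero).mp h4
      have h6 : t ^ (n' + 1) < t ^ n' := pow_lt_pow_right_of_lt_one₀ (zero_lt_iff.mpr ht0) ht1 (by omega)
      exact absurd (h5.trans_lt h6) (not_lt.mpr hlt.le)
    · -- `v z ³ ≤ t^{n₆} = (t^{n'})³` ⇒ `v z ≤ t^{n'}`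
      rw [hn', Nat.mul_comm, pow_mul] at h
      exact absurd ((pow_le_pow_iff_left₀ zero_le zero_le three_ne_zero).mp h) (not_le.mpr hlt)
  -- `v(∏) ≤ t^{n₆ + 2}`
  have hR : v ((2 * V.c₆ - cK ^ 3 * δ ^ 3) + 3 * V.c₄ * z) ≤ t ^ (n₆ + 2) := by
    refine (Valuation.map_add v _ _).trans (max_le ?_ ?_)
    · -- `2c₆ − c³Δ = 2c₆ · (1 − c³Δ/(2c₆))`
      have hc' : (1 - c ^ 3 * W.Δ / (2 * W.c₆)) = 0 ∨
          (2 : ℤ) ≤ padicValRat 3 (1 - c ^ 3 * W.Δ / (2 * W.c₆)) := by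
        rcases hc with h | h
        · left; linear_combination (-1 : ℚ) * h
        · right; rwa [show (1 - c ^ 3 * W.Δ / (2 * W.c₆)) = -(c ^ 3 * W.Δ / (2 * W.c₆) - 1) by ring,
            padicValRat.neg]
      have e : (2 * V.c₆ - cK ^ 3 * δ ^ 3) =
          algebraMap ℚ (AlgebraicClosure ℚ) (2 * W.c₆) *
            algebraMap ℚ (AlgebraicClosure ℚ) (1 - c ^ 3 * W.Δ / (2 * W.c₆)) := by
        rw [← map_mul, hVc₆, hcK, hδ3']
        have h2c : (2 : ℚ) * W.c₆ ≠ 0 := mul_ne_zero two_ne_zero hc₆0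
        rw [show (2 : ℚ) * W.c₆ * (1 - c ^ 3 * W.Δ / (2 * W.c₆)) = 2 * W.c₆ - c ^ 3 * W.Δ by
          field_simp]
        rw [map_sub, map_mul, map_mul, map_pow, map_ofNat]
      rw [e, Valuation.map_mul]
      have h2 : v (algebraMap ℚ (AlgebraicClosure ℚ) (2 * W.c₆)) = t ^ n₆ := by
        rw [map_mul, Valuation.map_mul, map_ofNat, hvc₆,
          show (2 : AlgebraicClosure ℚ) = ((2 : ℤ) : AlgebraicClosure ℚ) by norm_num,
          valuation_placeOver_intCast_eq_one 3 (n := 2) (by decide), one_mul]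
      rw [h2, pow_add]
      exact mul_le_mul' le_rfl (valuation_ratCast_le_pow_of_le_padicValRat hc')
    · -- `v(3 c₄ z) = t^{1+n₄} v z ≤ t^{1 + (2n'+1) + n'} = t^{n₆+2}`
      rw [Valuation.map_mul, Valuation.map_mul, hVc₄, hvc₄, ← ht]
      calc t * t ^ n₄ * v z ≤ t * t ^ (2 * n' + 1) * t ^ n' := by
            exact mul_le_mul' (mul_le_mul' le_rfl (pow_le_pow_right_of_le_one' ht1.le hn4)) hvz
        _ = t ^ (n₆ + 2) := by
            rw [← pow_succ', ← pow_add]; congr 1; omega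
  rw [← hprod] at hR
  -- pigeonhole: one factor has `v(z − cωᵏδ)³ ≤ t^{n₆+2}`
  have hpig : ∃ ρ : AlgebraicClosure ℚ, ρ ∈ W.divisionField 3 ∧ v (z - cK * ρ) ^ 3 ≤ t ^ (n₆ + 2) := by
    by_contra hnone
    push Not at hnone
    have h0 := hnone δ hδ0m
    have h1 := hnone (ω * δ) hδ1m
    have h2 := hnone (ω ^ 2 * δ) hδ2m
    have key : (t ^ (n₆ + 2)) ^ 3 <
        (v (z - cK * δ) * v (z - cK * (ω * δ)) * v (z - cK * (ω ^ 2 * δ))) ^ 3 := by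
      rw [mul_pow, mul_pow]
      calc (t ^ (n₆ + 2)) ^ 3 = t ^ (n₆ + 2) * t ^ (n₆ + 2) * t ^ (n₆ + 2) := by rw [pow_three, mul_assoc]
        _ < v (z - cK * δ) ^ 3 * v (z - cK * (ω * δ)) ^ 3 * v (z - cK * (ω ^ 2 * δ)) ^ 3 := by
          have hp : 0 < t ^ (n₆ + 2) := pow_pos (zero_lt_iff.mpr ht0) _
          exact mul_lt_mul'' (mul_lt_mul'' h0 h1 hp.le hp.le) h2 (mul_pos hp hp).le hp.le
    rw [← Valuation.map_mul, ← Valuation.map_mul] at key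
    exact absurd hR (not_le.mpr ((pow_lt_pow_iff_left₀ zero_le zero_le three_ne_zero).mp key))
  obtain ⟨ρ, hρm, hρ⟩ := hpig
  -- the approximant `β = (cρ − b₂)/12 ∈ ℚ(E[3]) ⊆ ℚ(E[9])`
  set β : AlgebraicClosure ℚ := (cK * ρ - V.b₂) / 12 with hβ
  have hβ9 : β ∈ W.divisionField 9 := by
    apply divisionField_three_le_nine W
    rw [hβ, hVb₂, hcK]
    refine div_mem (sub_mem (mul_mem (IntermediateField.algebraMap_mem _ _) hρm)
      (IntermediateField.algebraMap_mem _ _)) (IntermediateField.natCast_mem _ 12)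
  have heβ : e - β = (z - cK * ρ) / 12 := by rw [hβ, hz]; field_simp; ring
  have hv12 : v (12 : AlgebraicClosure ℚ) = t := by
    rw [show (12 : AlgebraicClosure ℚ) = ((12 : ℕ) : AlgebraicClosure ℚ) by norm_num,
      valuation_natCast_eq_pow (by norm_num), show padicValNat 3 12 = 1 by decide +kernel, pow_one]
  -- `v(e − β)³ · t³ ≤ t^{n₆+2}`, so `v(e − β)^{162} · t^{162} ≤ t^{54(n₆+2)}`
  have heβ3 : v (e - β) ^ 3 * t ^ 3 ≤ t ^ (n₆ + 2) := by
    rw [heβ, map_div₀, hv12, div_pow, div_mul_cancel₀ _ (pow_ne_zero 3 ht0)]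
    exact hρ
  -- `v(x₀ − e)^{162} · t³ = t^{27 nΔ}` with `27 nΔ + 159 < 54(n₆+2) + 3`… compare after scaling
  have hlt : v (e - β) < v (x₀ - e) := by
    -- raise to the 162nd power and multiply by `t^{162}`… we compare `A := v(e−β)^{162} t^{162}` and
    -- `B := v(x₀−e)^{162} t^{162} = t^{27nΔ + 159}`; `A ≤ t^{54 n₆ + 108}` and `54n₆+108 > 27nΔ+159`.
    have hA : v (e - β) ^ 162 * t ^ 162 ≤ t ^ (54 * (n₆ + 2)) := by
      have := pow_le_pow_left₀ zero_le heβ3 54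
      rw [mul_pow, ← pow_mul, ← pow_mul, ← pow_mul] at this
      simpa [Nat.mul_comm] using this
    have hB : v (x₀ - e) ^ 162 * t ^ 162 = t ^ (27 * nΔ + 159) := by
      rw [show t ^ 162 = t ^ 3 * t ^ 159 by rw [← pow_add], ← mul_assoc, hval', ← pow_add]
    have hexp : 27 * nΔ + 159 < 54 * (n₆ + 2) := by omega
    have hcmp : t ^ (54 * (n₆ + 2)) < t ^ (27 * nΔ + 159) :=
      pow_lt_pow_right_of_lt_one₀ (zero_lt_iff.mpr ht0) ht1 hexp
    have h162 : v (e - β) ^ 162 * t ^ 162 < v (x₀ - e) ^ 162 * t ^ 162 := by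
      rw [hB]; exact hA.trans_lt hcmp
    have h162' : v (e - β) ^ 162 < v (x₀ - e) ^ 162 :=
      lt_of_mul_lt_mul_right h162 zero_le
    exact (pow_lt_pow_iff_left₀ zero_le zero_le (by norm_num : (162 : ℕ) ≠ 0)).mp h162'
  have hvxβ : v (x₀ - β) = v (x₀ - e) := by
    rw [show x₀ - β = (x₀ - e) + (e - β) by ring]
    exact Valuation.map_add_eq_of_lt_left _ hlt
  -- the element `w = (x₀ − β)² ∈ ℚ(E[9])` with `v(w)²⁷ · t = t^{9 nΔ}`
  have hQ' : Q ∈ geomTorsion W ((9 : ℕ) : ℤ) := (mem_geomTorsion_iff W _ Q).mpr (by exact_mod_cast hQ9)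
  obtain ⟨hx₀L, -⟩ := W.mem_divisionField_of_eq_some (n := 9) (T := ⟨Q, hQ'⟩) hQxy
  have hwL : (x₀ - β) ^ 2 ∈ W.divisionField 9 := pow_mem (sub_mem hx₀L hβ9) 2
  have hw0 : (x₀ - β) ^ 2 ≠ 0 := by
    refine pow_ne_zero 2 fun h0 ↦ hxe0 ?_
    have : v (x₀ - e) = 0 := by rw [← hvxβ, h0, map_zero]
    exact (Valuation.zero_iff _).mp this
  have hcube : (v (x₀ - β) ^ 54 * t) ^ 3 = (t ^ (9 * nΔ)) ^ 3 := by
    rw [mul_pow, ← pow_mul, ← pow_mul, hvxβ, show (54 * 3 : ℕ) = 162 from rfl, hval']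
    congr 1; omega
  have h54 : v (x₀ - β) ^ 54 * t = t ^ (9 * nΔ) :=
    (pow_left_inj₀ zero_le zero_le three_ne_zero).mp hcube
  have hwval : v ((x₀ - β) ^ 2) ^ 27 * t ^ 1 = t ^ (9 * nΔ) := by
    rw [map_pow, ← pow_mul, pow_one]; exact h54
  have hcop : IsCoprime (27 : ℤ) (((1 : ℕ) : ℤ) - ((9 * nΔ : ℕ) : ℤ)) := by
    have e : (((1 : ℕ) : ℤ) - ((9 * nΔ : ℕ) : ℤ)) = 1 + 27 * 0 + (-9) * (nΔ : ℤ) := by push_cast; ring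
    rw [show (((1 : ℕ) : ℤ) - ((9 * nΔ : ℕ) : ℤ)) = 1 + 3 * (-(3 * (nΔ : ℤ))) by push_cast; ring]
    -- `27 = 3³` is coprime to `1 + 3k`
    have : IsCoprime (3 : ℤ) (1 + 3 * (-(3 * (nΔ : ℤ)))) := isCoprime_one_right.add_mul_left_right _
    simpa using this.pow_left (m := 3)
  have hd := dvd_card_inertia_map_galoisRepTorsion_of_valuation (W := W) (n := 9) hw hmem h𝔓 hwL hw0
    hwval hcop
  exact_mod_cast hd

/-- **THE `3`-ADIC TOWER ON THE CUBE-ROOT ROWS OF THE EXOTIC CORE (binder-free).**  `E/ℚ` with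
`v₃(c₄) = n₄`, `v₃(c₆) = n₆`, `v₃(Δ) = n_Δ` (naturals), `2n₆ = n_Δ + 3` (`v₃(j − 1728) = 3`),
`n_Δ + 6 ≤ 3n₄` (`v₃(j) ≥ 6`), `3 ∣ n₆` (`f₃ = 3`), `2c₆/Δ` a `3`-adic cube to second order, and
`ρ̄_{E,3}` onto ⟹ `ρ̄_{E,3ⁿ}` onto for every `n` (§ main theorem + gen-2's count criterion
`forall_hasSurjectiveModNGaloisRep_three_pow_of_surj_of_twentySeven_dvd`, p254468).
[cite: SerreAbelianLadic1968, Ch. IV §3.4, Lemma 3 (IV-23)] [cite: Serre1972, §5.3] -/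
theorem towerSurj_three_of_surj_of_cubeRoot (hsurj : W.HasSurjectiveModNGaloisRep 3)
    {n₄ n₆ nΔ : ℕ} (hc₄ : padicValRat 3 W.c₄ = n₄) (hc₆ : padicValRat 3 W.c₆ = n₆)
    (hΔ : padicValRat 3 W.Δ = nΔ) (hm : 2 * n₆ = nΔ + 3) (hj : nΔ + 6 ≤ 3 * n₄) (h3 : 3 ∣ n₆)
    (hc : ∃ c : ℚ, c ^ 3 * W.Δ / (2 * W.c₆) - 1 = 0 ∨
      (2 : ℤ) ≤ padicValRat 3 (c ^ 3 * W.Δ / (2 * W.c₆) - 1)) (n : ℕ) :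
    W.HasSurjectiveModNGaloisRep (3 ^ n : ℕ) := by
  obtain ⟨w, hw⟩ : ∃ w : HeightOneSpectrum (𝓞 ℚ), (primesEquiv w : ℕ) = 3 :=
    ⟨primesEquiv.symm ⟨3, Nat.prime_three⟩, by rw [Equiv.apply_symm_apply]⟩
  obtain ⟨𝔓, hmem, h𝔓⟩ := exists_ideal_placeOver 3 hw
  exact forall_hasSurjectiveModNGaloisRep_three_pow_of_surj_of_twentySeven_dvd W hsurj _
    (twentySeven_dvd_card_inertia_map_galoisRepTorsion_nine_of_cubeRoot W hc₄ hc₆ hΔ hm hj h3 hc hw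
      hmem h𝔓) n

/-- **Kato's (12.5.2) at `3` on the cube-root rows of the EXOTIC core**: the image of
`Gal(ℚ̄/ℚ(ζ_{3^∞}))` in `Aut(T₃E)` contains `SL₂(ℤ₃)` (certificate-free on these rows).
[cite: Kato2004Asterisque, (12.5.2) (p. 222)] [cite: SerreAbelianLadic1968, Ch. IV §3.4, Lemma 3 (IV-23)] -/
theorem imageContainsSL2_three_of_surj_of_cubeRoot (hsurj : W.HasSurjectiveModNGaloisRep 3)
    {n₄ n₆ nΔ : ℕ} (hc₄ : padicValRat 3 W.c₄ = n₄) (hc₆ : padicValRat 3 W.c₆ = n₆)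
    (hΔ : padicValRat 3 W.Δ = nΔ) (hm : 2 * n₆ = nΔ + 3) (hj : nΔ + 6 ≤ 3 * n₄) (h3 : 3 ∣ n₆)
    (hc : ∃ c : ℚ, c ^ 3 * W.Δ / (2 * W.c₆) - 1 = 0 ∨
      (2 : ℤ) ≤ padicValRat 3 (c ^ 3 * W.Δ / (2 * W.c₆) - 1)) :
    Kato2004.ImageContainsSL2 W 3 := by
  haveI : Fact (Nat.Prime 3) := ⟨Nat.prime_three⟩
  exact (Kato2004.imageContainsSL2_iff_forall_hasSurjectiveModNGaloisRep W 3).mpr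
    (towerSurj_three_of_surj_of_cubeRoot W hsurj hc₄ hc₆ hΔ hm hj h3 hc)

end Summit.BirchSwinnertonDyer.Rank1Residual.GaloisImage

end
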